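import Mathlib
import HarnessLib

/-!
# ValiantsHypothesis / LacunarySymmetroid — crux `MatrixDescartes` (stmt-ValiantsHypothesis-18050, V1),
# line «osculation-law», `stub_recursion` R6(a): (Dg) LINE-GENERICITY OF «`det G` HAS ONLY SIMPLE ROOTS»

val-port-3 g1's density-assembly spec (bus 2026-08-28 l.≈8158, condition (g)/(g′)): along an ε-polynomial family of
pencils the clause «the positive roots of `det G` are simple» must be transported from ONE good parameter (the
witness) to all but finitely many parameters.  The Zariski form of the clause is SEPARABILITY (`IsCoprime f f′`),
and this file proves the transport for any `f ∈ ℝ[ε][t]` (`ℝ[X][X]`, inner variable `ε`, outer `t`), `f_ε :=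
f.map (evalRingHom ε)`:

* `finite_bad_eps_of_map_ne_zero'` — a polynomial alive at one specialisation dies at finitely many (coefficientwise);
* ★ `finite_bad_eps_separable (f) (ε₁) (hdeg : natDegree f_{ε₁} = natDegree f) (hsep : f_{ε₁}.Separable) :
  {ε | natDegree f_ε < natDegree f ∨ ¬ f_ε.Separable}.Finite` — via `R := resultant f f′` at FIXED formal degrees
  `(N, N − 1)` over the base ring `ℝ[ε]` (`resultant_map_map`, `derivative_map`, padding `resultant_add_right_deg`
  by a power of the top coefficient, Mathlib `resultant_eq_zero_iff` over the field… no: over the DOMAIN `ℝ[t]` we use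
  `Polynomial.separable_def` + `resultant_ne_zero`/`resultant_eq_zero_iff` through the fraction-free route below);
* `nodup_roots_of_separable'` — the consumer's reading: separable ⇒ `roots.Nodup` (Mathlib `nodup_roots`);
* `map_det_letterPencil`, `map_det_letterPencil_segment` — INSTANTIATION (MvPolynomial side): the node curve
  `det(Σ_l X₀^{d l} • 𝔖_l + X₁ • M)` over any base `A` specialises under `MvPolynomial.map φ` to the curve of the
  mapped letters — the ε-polynomial NODE CURVES that val-lit-p5 g12's `finite_bad_eps_resultant`
  (`…OsculationLawUniformGeneric`) consumes (node 1: `M = 1`; Y-free node 2: `M = S_K + c•1`);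
* `map_segment_letter'`, `map_det_pencil_symbolic` — INSTANTIATION (univariate side): for ε-symbolic letters `𝔖 l` (entries in
  `ℝ[ε]`, e.g. the segment `(1 − X)•S_l + X•W_l`) the determinant of the pencil `Σ_l t^{d l} 𝔖_l`, an element of
  `ℝ[ε][t]`, specialises under `evalRingHom ε` to `det(Σ_l t^{d l} S^ε_l)` with `S^ε_l = (𝔖 l).map (eval ε)`.

Honest framing: helper bookkeeping for one density condition of an UNREGISTERED residue stub of a V1 law line;
`stub_recursion`, the LAW `stub_osculationLaw`, the crux `MatrixDescartes`, Conjecture B and `VP ≠ VNP` are OPEN /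
NOT proved.  No definitions, no named facts; Mathlib only.
-/

-- `Summit.ValiantsHypothesis.ValiantsHypothesis.…` is the tree's mandated single-conjunct layout (Sub = Summit).
set_option linter.dupNamespace false

noncomputable section

namespace Summit.ValiantsHypothesis.ValiantsHypothesis.Theorems.LacunarySymmetroidMatrixDescartes

namespace OsculationGeneric

open Polynomial
open scoped BigOperators

/-! ### Coefficientwise finiteness -/

/-- If `q ∈ ℝ[ε][t]` (inner variable `ε`) has `q.map (eval ε₁) ≠ 0`, then `{ε | q.map (eval ε) = 0}` is finite.
(Twin of `finite_bad_eps_of_map_ne_zero` of the resultant file, kept local to make this file self-contained.)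
[folklore] -/
theorem finite_bad_eps_of_map_ne_zero' (q : ℝ[X][X]) (ε₁ : ℝ) (h : q.map (evalRingHom ε₁) ≠ 0) :
    {ε : ℝ | q.map (evalRingHom ε) = 0}.Finite := by
  classical
  obtain ⟨j, hj⟩ : ∃ j, (q.coeff j).eval ε₁ ≠ 0 := by
    by_contra hall
    push Not at hall
    exact h (Polynomial.ext fun j => by rw [coeff_map, coe_evalRingHom, hall j, coeff_zero])
  have hq : q.coeff j ≠ 0 := fun h0 => hj (by rw [h0, eval_zero])
  refine ((q.coeff j).roots.toFinset.finite_toSet).subset fun ε hε => ?_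
  rw [Set.mem_setOf_eq] at hε
  rw [Finset.mem_coe, Multiset.mem_toFinset, mem_roots hq, IsRoot.def]
  have := congr_arg (fun p : ℝ[X] => p.coeff j) hε
  simpa [coeff_map] using this

/-- Finiteness of the zero set of a nonzero real polynomial, in the `eval` form. [folklore] -/
theorem finite_eval_eq_zero (q : ℝ[X]) (hq : q ≠ 0) : {ε : ℝ | q.eval ε = 0}.Finite := by
  classical
  refine (q.roots.toFinset.finite_toSet).subset fun ε hε => ?_
  rw [Finset.mem_coe, Multiset.mem_toFinset, mem_roots hq, IsRoot.def]
  exact hε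

/-! ### Separability is a resultant condition at fixed formal degrees -/

/-- For `g` of exact degree `N` over a field, the padded resultant `Res_{N, N−1}(g, g′)` is nonzero iff `g` is
separable. [folklore] -/
theorem resultant_derivative_ne_zero_iff {g : ℝ[X]} {N : ℕ} (hN : g.natDegree = N) (hg : g ≠ 0) :
    resultant g (derivative g) N (N - 1) ≠ 0 ↔ g.Separable := by
  classical
  have hlc : g.coeff N ≠ 0 := by rw [← hN]; exact leadingCoeff_ne_zero.2 hg
  -- padding the second formal degree
  have hle : (derivative g).natDegree ≤ N - 1 := by
    rw [← hN]; exact natDegree_derivative_le g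
  obtain ⟨k, hk⟩ := Nat.exists_eq_add_of_le hle
  have hpad : resultant g (derivative g) N (N - 1) =
      g.coeff N ^ k * resultant g (derivative g) N (derivative g).natDegree := by
    rw [hk, resultant_add_right_deg _ _ _ _ k le_rfl]
  have hres : resultant g (derivative g) N (derivative g).natDegree = resultant g (derivative g) := by
    rw [← hN]
  rw [hpad, hres]
  have key : resultant g (derivative g) ≠ 0 ↔ g.Separable := by
    rw [Ne, resultant_eq_zero_iff, separable_def]
    constructor
    · intro h
      by_contra hc
      exact h ⟨Or.inl hg, hc⟩
    · intro hc h
      exact h.2 hc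
  rw [mul_ne_zero_iff, key]
  exact ⟨fun h => h.2, fun h => ⟨pow_ne_zero _ hlc, h⟩⟩

/-! ### (Dg): genericity of separability along an ε-polynomial family -/

/-- **(Dg) Line-genericity of «only simple roots».**  Let `f ∈ ℝ[ε][t]`.  If ONE specialisation `f_{ε₁}` has the
full degree `natDegree f` and is separable, then the parameters at which the degree drops or separability fails
form a FINITE set. [folklore] -/
theorem finite_bad_eps_separable (f : ℝ[X][X]) (ε₁ : ℝ)
    (hdeg : (f.map (evalRingHom ε₁)).natDegree = f.natDegree) (hsep : (f.map (evalRingHom ε₁)).Separable) :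
    {ε : ℝ | (f.map (evalRingHom ε)).natDegree < f.natDegree ∨ ¬ (f.map (evalRingHom ε)).Separable}.Finite := by
  classical
  set N := f.natDegree with hNdef
  have hf₁ : f.map (evalRingHom ε₁) ≠ 0 := hsep.ne_zero
  -- the top coefficient, a polynomial in `ε`, alive at `ε₁`
  have hlc₁ : (f.coeff N).eval ε₁ ≠ 0 := by
    have h : (f.map (evalRingHom ε₁)).coeff N ≠ 0 := by
      rw [← hdeg]; exact leadingCoeff_ne_zero.2 hf₁
    rwa [coeff_map, coe_evalRingHom] at h
  have hlcne : f.coeff N ≠ 0 := fun h0 => hlc₁ (by rw [h0, eval_zero])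
  -- where the top coefficient survives, the degree is full
  have hfull : ∀ ε : ℝ, (f.coeff N).eval ε ≠ 0 → (f.map (evalRingHom ε)).natDegree = N := by
    intro ε hε
    refine le_antisymm (natDegree_map_le) ?_
    refine le_natDegree_of_ne_zero ?_
    rwa [coeff_map, coe_evalRingHom]
  -- the padded resultant over the base ring `ℝ[ε]`
  set R : ℝ[X] := resultant f (derivative f) N (N - 1) with hRdef
  have hR : ∀ ε : ℝ, R.eval ε =
      resultant (f.map (evalRingHom ε)) (derivative (f.map (evalRingHom ε))) N (N - 1) := by
    intro ε
    rw [derivative_map, resultant_map_map, hRdef, coe_evalRingHom]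
  -- alive at `ε₁`
  have hR₁ : R.eval ε₁ ≠ 0 := by
    rw [hR ε₁]
    exact (resultant_derivative_ne_zero_iff hdeg hf₁).2 hsep
  have hRne : R ≠ 0 := fun h0 => hR₁ (by rw [h0, eval_zero])
  -- the bad set sits inside two finite root sets
  refine ((finite_eval_eq_zero (f.coeff N) hlcne).union (finite_eval_eq_zero R hRne)).subset fun ε hε => ?_
  by_cases hlc : (f.coeff N).eval ε = 0
  · exact Or.inl hlc
  · right
    have hN := hfull ε hlc
    rcases hε with hlt | hns
    · exact absurd hN (by omega)
    · have hfε : f.map (evalRingHom ε) ≠ 0 := by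
        intro h0
        apply hlc
        have := congr_arg (fun p : ℝ[X] => p.coeff N) h0
        simpa [coeff_map] using this
      show R.eval ε = 0
      rw [hR ε]
      by_contra hne
      exact hns ((resultant_derivative_ne_zero_iff hN hfε).1 hne)

/-- **(Dg), formal-degree form**: if `natDegree f ≤ N` and ONE specialisation has degree exactly `N` and is
separable, then off a finite set of parameters every specialisation has degree `N` and is separable. [folklore] -/
theorem finite_bad_eps_separable' (f : ℝ[X][X]) (N : ℕ) (hN : f.natDegree ≤ N) (ε₁ : ℝ)
    (hdeg : (f.map (evalRingHom ε₁)).natDegree = N) (hsep : (f.map (evalRingHom ε₁)).Separable) :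
    {ε : ℝ | (f.map (evalRingHom ε)).natDegree < N ∨ ¬ (f.map (evalRingHom ε)).Separable}.Finite := by
  have hfN : f.natDegree = N := le_antisymm hN (hdeg ▸ natDegree_map_le)
  rw [← hfN]
  exact finite_bad_eps_separable f ε₁ (by rw [hdeg, hfN]) hsep

/-- The consumer's reading: a separable specialisation has pairwise distinct roots. [folklore] -/
theorem nodup_roots_of_separable' {g : ℝ[X]} (hg : g.Separable) : g.roots.Nodup :=
  nodup_roots hg

/-! ### Instantiation: determinants of pencils with ε-symbolic letters -/

section Letters

variable {ι : Type*} [Fintype ι] [DecidableEq ι]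

omit [Fintype ι] [DecidableEq ι] in
/-- The segment letter `(1 − X)•S + X•W` over `ℝ[ε]` specialises at `ε` to `(1 − ε)•S + ε•W`. [folklore] -/
theorem map_segment_letter' (S W : Matrix ι ι ℝ) (ε : ℝ) :
    ((((1 : ℝ[X]) - X) • S.map Polynomial.C + (X : ℝ[X]) • W.map Polynomial.C).map (eval ε)) =
      (1 - ε) • S + ε • W := by
  ext i j
  simp [Matrix.smul_apply, Matrix.add_apply]
  ring

/-- **Pencil determinants specialise.**  For ε-symbolic letters `𝔖 l` (entries in `ℝ[ε]`) the determinant of the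
pencil `Σ_l t^{d l} • 𝔖_l` — an element of `ℝ[ε][t]` — maps under `evalRingHom ε` (coefficientwise in `t`) to the
determinant of the pencil of the real letters `(𝔖 l).map (eval ε)`. [folklore] -/
theorem map_det_pencil_symbolic {K : ℕ} (d : Fin K → ℕ) (𝔖 : Fin K → Matrix ι ι ℝ[X]) (ε : ℝ) :
    ((∑ l, (X : ℝ[X][X]) ^ d l • (𝔖 l).map Polynomial.C).det).map (evalRingHom ε) =
      (∑ l, (X : ℝ[X]) ^ d l • ((𝔖 l).map (eval ε)).map Polynomial.C).det := by
  have hφ : ∀ q : ℝ[X][X], q.map (evalRingHom ε) = mapRingHom (evalRingHom ε) q := fun q => rfl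
  rw [hφ, RingHom.map_det, map_sum]
  congr 1
  refine Finset.sum_congr rfl fun l _ => ?_
  ext i j
  simp [Matrix.smul_apply, coe_mapRingHom, Polynomial.map_mul, Polynomial.map_pow]

/-- **(Dg) for pencils**: if at ONE parameter the pencil determinant of the real letters has full degree and is
separable, then for all but finitely many parameters it has full degree and is separable (hence simple roots).
[folklore] -/
theorem finite_bad_eps_det_separable {K : ℕ} (d : Fin K → ℕ) (𝔖 : Fin K → Matrix ι ι ℝ[X]) (ε₁ : ℝ)
    (hdeg : ((∑ l, (X : ℝ[X]) ^ d l • ((𝔖 l).map (eval ε₁)).map Polynomial.C).det).natDegree =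
      ((∑ l, (X : ℝ[X][X]) ^ d l • (𝔖 l).map Polynomial.C).det).natDegree)
    (hsep : ((∑ l, (X : ℝ[X]) ^ d l • ((𝔖 l).map (eval ε₁)).map Polynomial.C).det).Separable) :
    {ε : ℝ | ((∑ l, (X : ℝ[X]) ^ d l • ((𝔖 l).map (eval ε)).map Polynomial.C).det).natDegree <
        ((∑ l, (X : ℝ[X][X]) ^ d l • (𝔖 l).map Polynomial.C).det).natDegree ∨
      ¬ ((∑ l, (X : ℝ[X]) ^ d l • ((𝔖 l).map (eval ε)).map Polynomial.C).det).Separable}.Finite := by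
  have h := finite_bad_eps_separable ((∑ l, (X : ℝ[X][X]) ^ d l • (𝔖 l).map Polynomial.C).det) ε₁
    (by rw [map_det_pencil_symbolic]; exact hdeg) (by rw [map_det_pencil_symbolic]; exact hsep)
  refine h.subset fun ε hε => ?_
  simp only [Set.mem_setOf_eq] at hε ⊢
  rw [map_det_pencil_symbolic]
  exact hε

/-- **Letter pencils with an inserted letter specialise** (any base change `φ : A →+* B`): the bivariate polynomial
`det(Σ_l X₀^{d l} • 𝔖_l + X₁ • M)` over `A` maps under `MvPolynomial.map φ` to the same determinant of the mapped
letters — the instantiation brick for ε-polynomial NODE CURVES (node 1: `M = 1`; the Y-free node-2 model: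
`M = S_K + c•1`), feeding val-lit-p5 g12's `finite_bad_eps_resultant` (`…UniformGeneric`). [folklore] -/
theorem map_det_letterPencil {A B : Type*} [CommRing A] [CommRing B] (φ : A →+* B) {K : ℕ} (d : Fin K → ℕ)
    (𝔖 : Fin K → Matrix ι ι A) (M : Matrix ι ι A) :
    MvPolynomial.map φ
        (∑ l, (MvPolynomial.X (0 : Fin 2) : MvPolynomial (Fin 2) A) ^ d l •
            (𝔖 l).map (MvPolynomial.C : A →+* MvPolynomial (Fin 2) A)
          + (MvPolynomial.X (1 : Fin 2) : MvPolynomial (Fin 2) A) •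
            M.map (MvPolynomial.C : A →+* MvPolynomial (Fin 2) A)).det =
      (∑ l, (MvPolynomial.X (0 : Fin 2) : MvPolynomial (Fin 2) B) ^ d l •
            ((𝔖 l).map φ).map (MvPolynomial.C : B →+* MvPolynomial (Fin 2) B)
          + (MvPolynomial.X (1 : Fin 2) : MvPolynomial (Fin 2) B) •
            (M.map φ).map (MvPolynomial.C : B →+* MvPolynomial (Fin 2) B)).det := by
  rw [RingHom.map_det]
  congr 1
  ext i j
  simp [Matrix.add_apply, Matrix.smul_apply, Matrix.sum_apply, MvPolynomial.map_X, MvPolynomial.map_C]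

/-- The segment letters as ε-symbolic letters, `MvPolynomial` side: at `ε` the node-1-type curve of the segment is
the curve of the real letters `(1 − ε)•S_l + ε•W_l` (with any fixed inserted letter `M`). [folklore] -/
theorem map_det_letterPencil_segment {K : ℕ} (d : Fin K → ℕ) (S W : Fin K → Matrix ι ι ℝ) (M : Matrix ι ι ℝ)
    (ε : ℝ) :
    MvPolynomial.map (evalRingHom ε)
        (∑ l, (MvPolynomial.X (0 : Fin 2) : MvPolynomial (Fin 2) ℝ[X]) ^ d l •
            (((1 : ℝ[X]) - X) • (S l).map Polynomial.C + (X : ℝ[X]) • (W l).map Polynomial.C).map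
              (MvPolynomial.C : ℝ[X] →+* MvPolynomial (Fin 2) ℝ[X])
          + (MvPolynomial.X (1 : Fin 2) : MvPolynomial (Fin 2) ℝ[X]) •
            (M.map Polynomial.C).map (MvPolynomial.C : ℝ[X] →+* MvPolynomial (Fin 2) ℝ[X])).det =
      (∑ l, (MvPolynomial.X (0 : Fin 2) : MvPolynomial (Fin 2) ℝ) ^ d l •
            ((1 - ε) • S l + ε • W l).map (MvPolynomial.C : ℝ →+* MvPolynomial (Fin 2) ℝ)
          + (MvPolynomial.X (1 : Fin 2) : MvPolynomial (Fin 2) ℝ) •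
            M.map (MvPolynomial.C : ℝ →+* MvPolynomial (Fin 2) ℝ)).det := by
  rw [map_det_letterPencil]
  have hM : (M.map Polynomial.C).map (evalRingHom ε) = M := by
    ext i j; simp
  have hS : ∀ l, (((1 : ℝ[X]) - X) • (S l).map Polynomial.C + (X : ℝ[X]) • (W l).map Polynomial.C).map
      (evalRingHom ε) = (1 - ε) • S l + ε • W l := by
    intro l; ext i j; simp [Matrix.smul_apply, Matrix.add_apply]; ring
  simp only [hM, hS]

end Letters

end OsculationGeneric

end Summit.ValiantsHypothesis.ValiantsHypothesis.Theorems.LacunarySymmetroidMatrixDescartes
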